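import Summits.Ventures.GridStability.Models.NE39SP
import Summits.Ventures.GridStability.Lyapunov.StructurePreservingStepRoa
import HarnessLib

/-!
# GridStability/Bench/NE39SPStepDefs — POWER-TRANSFER STEPS on the 49-node STRUCTURE-PRESERVING New England
# instance: the post-step model «+s pu load picked up at bus node `i`, supplied by machine node `g`» and the
# injection-step theorem specialised to it (line «G2.b-NE39SP-LOADSTEP», file 0 of the instance series)

Cell `gridfusion` (LADDER-GRIDFUSION), seat gridfusion-lyap-1 (g9). INSTANCE OF RECORD BY NAME: model-2's
`Models/NE39SP.lean` (`NE39SP.params D`; data model-4 `bench/data/NE39/sp49/sp49.json` fddec35dcf838149 =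
[cite: Padiyar2013, App. D Tables D.1–D.4]; injections OF RECORD `P⁰ := f(δ₀)`). GENERIC THEOREM OF RECORD:
this seat's `Switch.step_resync_of_checkP` (`Lyapunov/StructurePreservingStepRoa.lean`). NO NEW DATA LITERAL.

WHAT IS HERE: `P0Q` (the injections of record as exact rationals — `P0Q_cast`: they ARE `(NE39SP.params D).P0`),
`Pstep i g s` (the post-step injections: record `+ s` at node `g`, `− s` at node `i`; balanced), `paramsStep i g s D`
(model-2's `NE39SP.params D` with ONLY the injections replaced — same couplings, inertias, `D`, machines), its
bookkeeping lemmas, and **`step_resync_NE39SP`** — the injection-step theorem for this instance modulo ONE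
hypothesis `C.checkP srcV tgtV wtLFQ (Pstep i g s) tLFQ 39`, discharged bus by bus in `Bench/NE39SPLoadStep*.lean`
with `decide`. THREE COLUMNS: CERTIFIED (there) = for MODEL M″ = MV-3 New England SP with the injections stepped
at `t = 0` (a sudden load pickup of `s` pu at bus node `i` SIMULTANEOUSLY supplied by machine `g`'s mechanical
power — a power-transfer step; network unchanged): existence of the post-step synchronous state (enclosed) and
re-synchronisation of EVERY solution from the pre-step synchronous state, for every `D > 0`; MODELLED = model-2's
tokens «MV-3 + lossless + MV-P + D(∀) + ω_s declared + V-frozen(LF) + |E|′(h12)» PLUS «instantaneous balanced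
step (no governor / AGC dynamics: the supplying machine's mechanical power steps at t = 0), constant-power
frequency-dependent load, magnitudes frozen»; VALIDATED = nothing. No sentence here says the New England system is
stable. Three definitions (`P0Q`, `Pstep`, `paramsStep`); no named fact; standard axioms.
-/

noncomputable section

open Set Filter Topology Real Finset
open Summit.Ventures.GridStability.Models
open Summit.Ventures.GridStability.Models.StructurePreserving
open Summit.Ventures.GridStability.Models.NE39SP
open Summit.Ventures.GridStability.Lyapunov.StructurePreserving
open Summit.Ventures.GridStability.Lyapunov.StructurePreserving.Switch

namespace Summit.Ventures.GridStability.Bench.NE39SP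

/-- **The injections of record as exact rationals**: `P⁰ᵢ = fᵢ(δ₀)` evaluated by the rational mirror `flowQ`
on model-2's literals (column LF couplings, half-angle tangents). [folklore] -/
def P0Q (i : Fin 49) : ℚ := flowQ NE39SP.srcV NE39SP.tgtV NE39SP.wtLFQ NE39SP.tLFQ i

/-- `P0Q` IS the injection vector of model-2's instance: `(P0Q i : ℝ) = (NE39SP.params D).P0 i`. [folklore] -/
theorem P0Q_cast (D : Fin 49 → ℝ) (i : Fin 49) : ((P0Q i : ℚ) : ℝ) = (NE39SP.params D).P0 i := by
  unfold P0Q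
  rw [flowQ_cast]
  show _ = (NE39SP.params D).pe NE39SP.δ₀ i
  rw [Params.pe, params_b]
  exact (pe_halfAngle_eq_flowQ NE39SP.srcV NE39SP.tgtV NE39SP.wt NE39SP.t i).symm

/-- **Post-step injections** of the power-transfer step «`s` pu of load picked up at node `i`, supplied by
machine node `g`»: the record plus `s` at `g` minus `s` at `i` (balanced). MODELLED: instantaneous step. [folklore] -/
def Pstep (i g : Fin 49) (s : ℚ) (j : Fin 49) : ℚ :=
  P0Q j + (if j = g then s else 0) - (if j = i then s else 0)

/-- **The post-step structure-preserving data** `M″`: model-2's `NE39SP.params D` with the injections replaced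
by `Pstep i g s` — SAME couplings, inertias, damping / load-frequency vector `D` and machines. MODEL MV-3. [folklore] -/
def paramsStep (i g : Fin 49) (s : ℚ) (D : Fin 49 → ℝ) : Params 49 :=
  { NE39SP.params D with P0 := fun j => (Pstep i g s j : ℝ) }

/-- Unfolding: the couplings are model-2's column-LF edge-list couplings. [folklore] -/
theorem paramsStep_b (i g : Fin 49) (s : ℚ) (D : Fin 49 → ℝ) :
    (paramsStep i g s D).b = symmetrize (edgeWeight NE39SP.srcV NE39SP.tgtV fun e => (NE39SP.wtLFQ e : ℝ)) :=
  rfl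

/-- Unfolding: the injections are the stepped rationals. [folklore] -/
theorem paramsStep_P0 (i g : Fin 49) (s : ℚ) (D : Fin 49 → ℝ) (j : Fin 49) :
    (paramsStep i g s D).P0 j = (Pstep i g s j : ℝ) := rfl

/-- **Well-formedness of the post-step data** (model-2's `NE39SP.wellFormed`: sign pattern of `M`, `D > 0`,
symmetric couplings). [folklore] -/
theorem paramsStep_wellFormed (i g : Fin 49) (s : ℚ) {D : Fin 49 → ℝ} (hD : ∀ j, 0 < D j) :
    (paramsStep i g s D).WellFormed where
  M_pos := (NE39SP.wellFormed hD).M_pos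
  M_eq_zero := (NE39SP.wellFormed hD).M_eq_zero
  D_pos := hD
  b_symm := (NE39SP.wellFormed hD).b_symm

/-- **THE INJECTION-STEP THEOREM FOR THE NEW ENGLAND SP INSTANCE, modulo one rational check.** For nodes `i`
(load pickup) and `g` (supplying machine), a step `s`, and a certificate `C` with
`C.checkP srcV tgtV wtLFQ (Pstep i g s) tLFQ 39`: for EVERY damping / load-frequency vector `D > 0`, the post-step
model `M″ = paramsStep i g s D` HAS a synchronous angle vector `θ` (all 49 power-flow equations `fⱼ(θ) = P¹ⱼ`
exactly; pinned at G1's internal node to the certificate's half-angle point and within `R` of it everywhere;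
every coupled branch inside `2·arctan τγ < π/2`), and EVERY solution of `M″` AS PRINTED starting at the PRE-step
synchronous state (`δ(0) = δ₀`, zero machine frequency deviations) keeps Vu–Turitsyn's polytope and
`V(θ; δ, δ̇) ≤ c` for all `t ≥ 0` and re-synchronises: `δ(t) → θ + κ·1`, `κ = Σ Dⱼ(δ₀ⱼ − θⱼ)/Σ Dⱼ`, machine
speeds `→ 0`. MODEL MV-3; no sentence here says the New England system is stable.
[cite: VuTuritsyn2016, §IV, §VI; Padiyar2013, App. D] -/
theorem step_resync_NE39SP {i g : Fin 49} {s : ℚ} {C : Cert 49 56}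
    (hchk : C.checkP NE39SP.srcV NE39SP.tgtV NE39SP.wtLFQ (Pstep i g s) NE39SP.tLFQ 39)
    (D : Fin 49 → ℝ) (hD : ∀ j, 0 < D j) :
    ∃ θ : Fin 49 → ℝ,
      θ 39 = halfAngle (fun j => (C.t1 j : ℝ)) 39 ∧
      (∀ j, |θ j - halfAngle (fun j => (C.t1 j : ℝ)) j| < (C.R : ℝ)) ∧
      (∀ j, (paramsStep i g s D).pe θ j = (paramsStep i g s D).P0 j) ∧
      (∀ a b, a ≠ b → (paramsStep i g s D).b a b ≠ 0 → |θ a - θ b| < 2 * Real.arctan (C.τγ : ℝ)) ∧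
      ∀ δ : ℝ → Fin 49 → ℝ, (paramsStep i g s D).IsSolution δ → δ 0 = NE39SP.δ₀ →
        (∀ j ∈ NE39SP.genS, deriv (fun u => δ u j) 0 = 0) →
        (∀ t, 0 ≤ t →
            (∀ a b, (paramsStep i g s D).b a b ≠ 0 → |(δ t a - δ t b) + (θ a - θ b)| < π) ∧
              (paramsStep i g s D).energy θ (δ t) (fun j => deriv (fun u => δ u j) t) ≤ (C.c : ℝ)) ∧
          Tendsto δ atTop (𝓝 fun j => θ j + (∑ k, D k * (NE39SP.δ₀ k - θ k)) / ∑ k, D k) ∧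
          ∀ j ∈ NE39SP.genS, Tendsto (fun t => deriv (fun u => δ u j) t) atTop (𝓝 0) :=
  step_resync_of_checkP hchk (by decide) (paramsStep_wellFormed i g s hD) (paramsStep_b i g s D)
    (paramsStep_P0 i g s D)

end Summit.Ventures.GridStability.Bench.NE39SP

end
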